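import Summits.KontsevichZagierPeriods.KontsevichZagierPeriods.Theses.HurwitzMicroSectors
import Literature.NumberTheory.Transcendental.KZLogCalculusProofs

/-!
# Crux `HurwitzSectorComplement` (stmt-KontsevichZagierPeriods-14341, route HurwitzMicroSectors) —
# line `galois-parity-half`: SKELETON (lead prover)

The crux `HurwitzSectorComplement := SectorTwoSix → AperySectorThreeTwo → NormalFormPrinciple` is the
declared summit-strength remainder of the route (Disproof.lean `crux_iff_summit`). The line closes
Conjecture 1 UNCONDITIONALLY-modulo-Okada on the whole **symmetric (Bernoulli-parity) Hurwitz tower**: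
all representations `[(0,1)^w, Q(t) + R(t)/(1 − t^N)]`, `t = x₁⋯x_w`, `Q, R ∈ ℚ[t]`, `deg R < N`,
`R` `(−1)^w`-symmetric (`R_i = (−1)^w R_{N−2−i}`, and `R_{N−1} = 0` for odd `w`), for ALL weights
`w ≥ 2` and levels `N ≥ 1`, across weights and levels (`symmetricTowerSector`, proved below from the
stubs S1–S6); the off-tower remainder is the declared summit-strength stub S7.

Stubs (registered; each lands as its own `Theorems/HurwitzMicroSectorsHurwitzSectorComplementStub*.lean`):
* S1 `stub_symReduction` — calculus: a symmetric rep of level `N ∣ L`, `L ≥ 3`, is KZ-equivalent to a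
  NORMAL FORM at level `L`: `c + Σ_{a ∈ T_L} μ_a (t^{a−1} + (−1)^w t^{L−1−a})/(1 − t^L)` on the box,
  `T_L = {0 < a < L/2, gcd(a,L) = 1}` (dilations `xᵢ ↦ xᵢ^g`, `g ∣ L` = distribution relations, item
  `DilationMove` PROVED; Jacobian monomials for the polynomial part; integrand additivity; Kubert
  generation over `ℚ` via `KZ.scale` / integer division).
* S2 `stub_nfValue` — value of the normal form: `c + Σ μ_a K(w,L,a)`,
  `K(w,L,a) = Σ_k (Lk+a)^{−w} + (−1)^w Σ_k (Lk+L−a)^{−w}` (`= L^{−w} g_w(a/L)`), Tonelli on `(0,1)^w`.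
* S3 `stub_pairValueAlgebraic` — `K(w,L,a)/π^w` is algebraic (Bernoulli–Fourier: `g_w(b/L) ∈ (πi)^w ℚ(ζ_L)`).
* S4 `stub_okada` — Okada 1981 / Gun–Murty–Rath 2011 Thm 1: the `K(w,L,a)`, `a ∈ T_L`, are
  `ℚ`-linearly independent (`w ≥ 2`, `L ≥ 3`). LEAD's stub.
* S5 `stub_rigidityNumbers` — given S3, S4 as hypotheses: `c + Σ μ_a K(w,·) = c' + Σ μ'_a K(w',·)`
  forces `c = c'` and (`w = w'` ⇒ `μ = μ'`) and (`w ≠ w'` ⇒ `μ = μ' = 0`) (Lindemann: `transcendental_pi_holds`).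
* S6 `stub_constAcrossDim` — equal constants on boxes of different dimensions are KZ-equivalent (slabs).
* S7 `stub_offSymmetricTower` — DECLARED SUMMIT-STRENGTH remainder: the tower sector ⇒ `NormalFormPrinciple`
  (≡ summit given the sector; never claimed).
-/

noncomputable section

open Set MeasureTheory
open scoped BigOperators
open Literature.NumberTheory.Transcendental

namespace Summit.KontsevichZagierPeriods.Theorems.HurwitzMicroSectorsHurwitzSectorComplement

open Summit.KontsevichZagierPeriods.KontsevichZagierPeriods.Theses.HurwitzMicroSectors

/-! ## The stubs -/

/-- **S1 (reduction half, calculus only).** Every symmetric representation of weight `w ≥ 2` and level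
`N ∣ L` (`L ≥ 3`) is KZ-equivalent to a normal form on the primitive symmetric basis of level `L`.
[cite: Milnor1983, §1] [cite: Lang1990, Ch. 2 §8–9] -/
theorem stub_symReduction : ∀ (w N L : ℕ), 2 ≤ w → 1 ≤ N → 3 ≤ L → N ∣ L → ∀ (r : KZ.IntegralRep w) (Q R : Polynomial ℚ), R.natDegree < N → (∀ i j : ℕ, i + j + 2 = N → R.coeff i = (-1 : ℚ) ^ w * R.coeff j) → (Odd w → R.coeff (N - 1) = 0) → r.domain = {x | ∀ i, x i ∈ Set.Ioo (0:ℝ) 1} → Set.EqOn r.integrand (fun x => Polynomial.aeval (∏ i, x i) Q + Polynomial.aeval (∏ i, x i) R / (1 - (∏ i, x i) ^ N)) r.domain → ∃ (c : ℚ) (μ : ℕ → ℚ) (r' : KZ.IntegralRep w), r'.domain = {x | ∀ i, x i ∈ Set.Ioo (0:ℝ) 1} ∧ Set.EqOn r'.integrand (fun x => (c : ℝ) + ∑ a ∈ (Finset.range L).filter (fun a => 2 * a < L ∧ Nat.Coprime a L), (μ a : ℝ) * (((∏ i, x i) ^ (a - 1) + (-1 : ℝ) ^ w * (∏ i, x i)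 ^ (L - 1 - a)) / (1 - (∏ i, x i) ^ L))) r'.domain ∧ KZ.Equivalent r r' := by
  sorry

/-- **S2 (value of the normal form).** [folklore] -/
theorem stub_nfValue : ∀ (w L : ℕ) (c : ℚ) (μ : ℕ → ℚ) (r : KZ.IntegralRep w), 2 ≤ w → 3 ≤ L → r.domain = {x | ∀ i, x i ∈ Set.Ioo (0:ℝ) 1} → Set.EqOn r.integrand (fun x => (c : ℝ) + ∑ a ∈ (Finset.range L).filter (fun a => 2 * a < L ∧ Nat.Coprime a L), (μ a : ℝ) * (((∏ i, x i) ^ (a - 1) + (-1 : ℝ) ^ w * (∏ i, x i) ^ (L - 1 - a)) / (1 - (∏ i, x i) ^ L))) r.domain → r.value = (c : ℝ) + ∑ a ∈ (Finset.range L).filter (fun a => 2 * a < L ∧ Nat.Coprime a L), (μ a : ℝ) * ((∑' k : ℕ, 1 / ((L : ℝ) * k + a) ^ w) + (-1 : ℝ) ^ w * (∑' k : ℕ, 1 / ((L : ℝ) * k + ((L : ℝ) - a)) ^ w)) := by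
  sorry

/-- **S3 (the symmetric Hurwitz values are algebraic multiples of `π^w`).**
`K(w,L,a)/π^w ∈ ℚ̄` (indeed `∈ i^w ℚ(ζ_L)`: Bernoulli–Fourier series). [folklore] -/
theorem stub_pairValueAlgebraic : ∀ (w L a : ℕ), 2 ≤ w → 0 < a → a < L → IsAlgebraic ℚ (((∑' k : ℕ, 1 / ((L : ℝ) * k + a) ^ w) + (-1 : ℝ) ^ w * (∑' k : ℕ, 1 / ((L : ℝ) * k + ((L : ℝ) - a)) ^ w)) / Real.pi ^ w) := by
  sorry

/-- **S4 (Okada's theorem, Hurwitz form).** For `w ≥ 2`, `L ≥ 3` the numbers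
`K(w,L,a) = L^{-w}(ζ(w,a/L) + (−1)^w ζ(w,1−a/L))`, `0 < a < L/2`, `gcd(a,L) = 1`, are `ℚ`-linearly independent.
[cite: Okada1981, Theorem] [cite: GunMurtyRath2011, Thm 1] -/
theorem stub_okada : ∀ (w L : ℕ), 2 ≤ w → 3 ≤ L → LinearIndependent ℚ (fun a : {a : ℕ // a ∈ (Finset.range L).filter (fun a => 2 * a < L ∧ Nat.Coprime a L)} => (∑' k : ℕ, 1 / ((L : ℝ) * k + a.1) ^ w) + (-1 : ℝ) ^ w * (∑' k : ℕ, 1 / ((L : ℝ) * k + ((L : ℝ) - a.1)) ^ w)) := by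
  sorry

/-- **S5 (rigidity of the numbers, from S3 + S4 + Lindemann).** [folklore] -/
theorem stub_rigidityNumbers : (∀ (w L a : ℕ), 2 ≤ w → 0 < a → a < L → IsAlgebraic ℚ (((∑' k : ℕ, 1 / ((L : ℝ) * k + a) ^ w) + (-1 : ℝ) ^ w * (∑' k : ℕ, 1 / ((L : ℝ) * k + ((L : ℝ) - a)) ^ w)) / Real.pi ^ w)) → (∀ (w L : ℕ), 2 ≤ w → 3 ≤ L → LinearIndependent ℚ (fun a : {a : ℕ // a ∈ (Finset.range L).filter (fun a => 2 * a < L ∧ Nat.Coprime a L)} => (∑' k : ℕ, 1 / ((L : ℝ) * k + a.1) ^ w) + (-1 : ℝ) ^ w * (∑' k : ℕ, 1 / ((L : ℝ) * k + ((L : ℝ) - a.1)) ^ w))) → ∀ (w w' L : ℕ) (c c' : ℚ) (μ μ' : ℕ → ℚ), 2 ≤ w → 2 ≤ w' → 3 ≤ L → (c : ℝ) + ∑ a ∈ (Finset.range L).filter (fun a => 2 * a < L ∧ Nat.Coprime a L), (μ a : ℝ) * ((∑' k : ℕ, 1 / ((L : ℝ) * k + a) ^ w) + (-1 : ℝ)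 ^ w * (∑' k : ℕ, 1 / ((L : ℝ) * k + ((L : ℝ) - a)) ^ w)) = (c' : ℝ) + ∑ a ∈ (Finset.range L).filter (fun a => 2 * a < L ∧ Nat.Coprime a L), (μ' a : ℝ) * ((∑' k : ℕ, 1 / ((L : ℝ) * k + a) ^ w') + (-1 : ℝ) ^ w' * (∑' k : ℕ, 1 / ((L : ℝ) * k + ((L : ℝ) - a)) ^ w')) → c = c' ∧ (w = w' → ∀ a ∈ (Finset.range L).filter (fun a => 2 * a < L ∧ Nat.Coprime a L), μ a = μ' a) ∧ (w ≠ w' → ∀ a ∈ (Finset.range L).filter (fun a => 2 * a < L ∧ Nat.Coprime a L), μ a = 0 ∧ μ' a = 0) := by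
  sorry

/-- **S6 (constants across dimensions).** Equal rational constants on open unit boxes of any two positive
dimensions are KZ-equivalent (slabs + null faces). [cite: KontsevichZagier2001, §1.2 rule (3)] -/
theorem stub_constAcrossDim : ∀ (w w' : ℕ) (c : ℚ) (ρ : KZ.IntegralRep w) (ρ' : KZ.IntegralRep w'), 1 ≤ w → 1 ≤ w' → ρ.domain = {x | ∀ i, x i ∈ Set.Ioo (0:ℝ) 1} → Set.EqOn ρ.integrand (fun _ => (c : ℝ)) ρ.domain → ρ'.domain = {x | ∀ i, x i ∈ Set.Ioo (0:ℝ) 1} → Set.EqOn ρ'.integrand (fun _ => (c : ℝ)) ρ'.domain → KZ.Equivalent ρ ρ' := by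
  sorry

/-- **S7 (DECLARED SUMMIT-STRENGTH REMAINDER, never claimed).** Conjecture 1 on the symmetric Hurwitz
tower implies the route's target `NormalFormPrinciple` (≡ the summit, Disproof.lean `nfp_iff_summit`).
[cite: KontsevichZagier2001, §1.2 Conjecture 1] -/
theorem stub_offSymmetricTower : (∀ (w N w' N' : ℕ), 2 ≤ w → 1 ≤ N → 2 ≤ w' → 1 ≤ N' → ∀ (r : KZ.IntegralRep w) (r' : KZ.IntegralRep w'), (∃ (Q R : Polynomial ℚ), R.natDegree < N ∧ (∀ i j : ℕ, i + j + 2 = N → R.coeff i = (-1 : ℚ) ^ w * R.coeff j) ∧ (Odd w → R.coeff (N - 1) = 0) ∧ r.domain = {x | ∀ i, x i ∈ Set.Ioo (0:ℝ) 1} ∧ Set.EqOn r.integrand (fun x => Polynomial.aeval (∏ i, x i) Q + Polynomial.aeval (∏ i, x i) R / (1 - (∏ i, x i) ^ N)) r.domain) → (∃ (Q R : Polynomial ℚ), R.natDegree < N' ∧ (∀ i j : ℕ, i + j + 2 = N' → R.coeff i = (-1 : ℚ) ^ w' * R.coeff j) ∧ (Odd w' → R.coeff (N' - 1) = 0) ∧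 r'.domain = {x | ∀ i, x i ∈ Set.Ioo (0:ℝ) 1} ∧ Set.EqOn r'.integrand (fun x => Polynomial.aeval (∏ i, x i) Q + Polynomial.aeval (∏ i, x i) R / (1 - (∏ i, x i) ^ N')) r'.domain) → r.value = r'.value → KZ.Equivalent r r') → NormalFormPrinciple := by
  sorry

/-! ## Composition (sorry-free): S1–S6 ⇒ the symmetric tower sector; + S7 ⇒ the crux by name -/

/-- **Conjecture 1 on the whole symmetric Hurwitz tower** (all weights `w ≥ 2`, all levels `N ≥ 1`,
across weights and levels), from the stubs S1–S6: lift both representations to the common level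
`L = 3NN'`, reduce to normal forms (S1), read the values (S2, soundness), compare (S5 fed by S3, S4):
equal weight ⇒ identical normal forms ⇒ one congruence move; different weights ⇒ both normal forms are
the same constant ⇒ S6. [cite: GunMurtyRath2011, Thm 1] [cite: KontsevichZagier2001, §1.2] -/
theorem symmetricTowerSector : ∀ (w N w' N' : ℕ), 2 ≤ w → 1 ≤ N → 2 ≤ w' → 1 ≤ N' → ∀ (r : KZ.IntegralRep w) (r' : KZ.IntegralRep w'), (∃ (Q R : Polynomial ℚ), R.natDegree < N ∧ (∀ i j : ℕ, i + j + 2 = N → R.coeff i = (-1 : ℚ) ^ w * R.coeff j) ∧ (Odd w → R.coeff (N - 1) = 0) ∧ r.domain = {x | ∀ i, x i ∈ Set.Ioo (0:ℝ) 1} ∧ Set.EqOn r.integrand (fun x => Polynomial.aeval (∏ i, x i) Q + Polynomial.aeval (∏ i, x i) R / (1 - (∏ i, x i) ^ N)) r.domain) → (∃ (Q R : Polynomial ℚ), R.natDegree < N' ∧ (∀ i j : ℕ, i + j + 2 = N' → R.coeff i = (-1 : ℚ) ^ w' * R.coeff j) ∧ (Odd w' → R.coeff (N' - 1) = 0) ∧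 r'.domain = {x | ∀ i, x i ∈ Set.Ioo (0:ℝ) 1} ∧ Set.EqOn r'.integrand (fun x => Polynomial.aeval (∏ i, x i) Q + Polynomial.aeval (∏ i, x i) R / (1 - (∏ i, x i) ^ N')) r'.domain) → r.value = r'.value → KZ.Equivalent r r' := by
  intro w N w' N' hw hN hw' hN' r r' ⟨Q, R, hR, hsym, hodd, hd, hf⟩ ⟨Q', R', hR', hsym', hodd', hd', hf'⟩ hv
  -- a common level `L = 3·N·N' ≥ 3`
  obtain ⟨L, hL⟩ : ∃ L : ℕ, L = 3 * (N * N') := ⟨_, rfl⟩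
  have hL3 : 3 ≤ L := by
    have h1 : 1 ≤ N * N' := Nat.one_le_iff_ne_zero.mpr (Nat.mul_ne_zero (by omega) (by omega))
    rw [hL]
    calc 3 = 3 * 1 := by norm_num
      _ ≤ 3 * (N * N') := Nat.mul_le_mul_left 3 h1
  have hNL : N ∣ L := ⟨3 * N', by rw [hL]; ring⟩
  have hN'L : N' ∣ L := ⟨3 * N, by rw [hL]; ring⟩
  -- S1: normal forms at level `L`
  obtain ⟨c, μ, n, hnd, hnf, hrn⟩ := stub_symReduction w N L hw hN hL3 hNL r Q R hR hsym hodd hd hf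
  obtain ⟨c', μ', n', hnd', hnf', hrn'⟩ :=
    stub_symReduction w' N' L hw' hN' hL3 hN'L r' Q' R' hR' hsym' hodd' hd' hf'
  -- S2 + soundness: the values
  have hvn := stub_nfValue w L c μ n hw hL3 hnd hnf
  have hvn' := stub_nfValue w' L c' μ' n' hw' hL3 hnd' hnf'
  have h1 : r.value = n.value := KZ.Equivalent.value_eq_holds hrn
  have h2 : r'.value = n'.value := KZ.Equivalent.value_eq_holds hrn'
  have heq := hv
  rw [h1, h2, hvn, hvn'] at heq
  -- S5 (with S3, S4): compare coefficients
  obtain ⟨hcc, hsame, hdiff⟩ :=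
    stub_rigidityNumbers stub_pairValueAlgebraic stub_okada w w' L c c' μ μ' hw hw' hL3 heq
  subst hcc
  by_cases hww : w = w'
  · -- equal weights: the two normal forms coincide on the box
    subst hww
    have hμ := hsame rfl
    have hnn' : KZ.Equivalent n n' := by
      refine KZ.of_sub_of_mem_relations_of_eqOn (by rw [hnd, hnd']) fun x hx => ?_
      have hx' : x ∈ n'.domain := by rw [hnd']; rw [hnd] at hx; exact hx
      rw [hnf hx, hnf' hx']
      refine congrArg₂ (· + ·) rfl (Finset.sum_congr rfl fun a ha => ?_)
      rw [hμ a ha]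
    exact (hrn.trans hnn').trans hrn'.symm
  · -- different weights: both normal forms are the constant `c`
    have hμ0 := hdiff hww
    have hnc : Set.EqOn n.integrand (fun _ => (c : ℝ)) n.domain := fun x hx => by
      rw [hnf hx]
      simp only
      rw [Finset.sum_eq_zero fun a ha => by rw [(hμ0 a ha).1]; push_cast; ring, add_zero]
    have hnc' : Set.EqOn n'.integrand (fun _ => (c : ℝ)) n'.domain := fun x hx => by
      rw [hnf' hx]
      simp only
      rw [Finset.sum_eq_zero fun a ha => by rw [(hμ0 a ha).2]; push_cast; ring, add_zero]
    have hnn' : KZ.Equivalent n n' :=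
      stub_constAcrossDim w w' c n n' (by omega) (by omega) hnd hnc hnd' hnc'
    exact (hrn.trans hnn').trans hrn'.symm

/-- **The crux, by name, from the stubs** (S1–S6 give the symmetric tower, S7 is the declared
summit-strength remainder). [cite: KontsevichZagier2001, §1.2 Conjecture 1] -/
theorem HurwitzSectorComplement_of : HurwitzSectorComplement :=
  fun _ _ => stub_offSymmetricTower symmetricTowerSector

end Summit.KontsevichZagierPeriods.Theorems.HurwitzMicroSectorsHurwitzSectorComplement

end
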